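/-
Copyright: the b2b-balaban T⁴-continuum CRUX team, row NE7b leaf lineage `t4-ne7b-formalise-leaf-04` (gen 153). Project licence.
-/
import Mathlib.Analysis.Calculus.ContDiff.Defs
import Mathlib.Analysis.Calculus.FDeriv.Basic
import Mathlib.Analysis.Normed.Operator.Prod
import Mathlib.Topology.MetricSpace.Lipschitz

/-!
# THE HARD STEP'S BACKGROUND FIELD IS `C¹` WITH A MODULUS: `‖σ′(w) − σ′(w′)‖ ≤ (N⁻¹ − c)⁻² ‖V″(σ w) − V″(σ w′)‖`
# — the propagator of the Hessian varies along the branch exactly as the Hessian does (resolvent identity), so a third-derivative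
# letter `‖V″ x − V″ x′‖ ≤ M₃‖x − x′‖` makes `σ′` Lipschitz with constant `(N⁻¹ − c)⁻³ M₃` and `σ ∈ C¹(ball)`; the sequel of
# `…HardStepBranchDeriv` (HSBD) in HSBD's own letters, Mathlib only
# (row NE7b, node U5c; TRANSFER rows (ix)∕(xxiv): [B11] CMP 102 p. 307 (182)–(190) «(δ∕δB)ℋ(B) … has regularity and decay properties
# identical to the propagator H», p. 296 «analyticity … uniform limit of successive approximations»; [folklore])

Cell `pub-balaban`, sub-cell `t4`, spine estimate NE7b (`T4WeightBudget.RelWeightBound`; the cell's OWN estimate — NOT PRINTED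
in [Bałaban 1983–89], NOT PROVED).  Crux-route work under `Spine/NE7b/` by leaf-04 (CRUX team (2), FREEZE (0) crux-prover clause).
NOTHING of Bałaban's is named, asserted, valued or discharged; no `T4Continuum/Support` leaf typed; no `def`; zero `sorry`.  Imports
Mathlib ONLY — independent of the `Spine/NE7b` olean frontier: HSBD's CONCLUSIONS (for `w` in the open ball an equivalence `A_w` with
`A_w = Φ′(σ w)`, `‖A_w⁻¹ z‖ ≤ L‖z‖`, `HasFDerivAt σ (A_w⁻¹ ∘ inl) w`) enter as displayed hypotheses — letters in, letters out; nothing of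
HSBD ∕ HSCR ∕ CMR imported or restated.

WHY.  `…HardStepChartRadius` (HSCR) puts the branch `σ` of ι-critical points on a chart of radius `(N⁻¹ − c)·r` with Lipschitz constant
`(N⁻¹ − c)⁻¹`; HSBD differentiates it: `σ′(w) = A_w⁻¹ ∘ inl` with `A_w h = (D h, V″(σ w) h ∘ ι)` the augmented Hessian AT `σ w`,
`‖σ′(w)‖ ≤ (N⁻¹ − c)⁻¹`, and says NOT HERE: «continuity ∕ higher regularity of `w ↦ σ′(w)` with constants (needs a modulus for `V″`)».
Print needs exactly that one storey up: the propagator's dependence on the background ([B11] (182)–(190): the derivative of the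
minimiser in the kept variable has «properties identical to the propagator», and the expansion in `B` continues).  THIS FILE: (§1) the
resolvent identity `A⁻¹ − B⁻¹ = A⁻¹ (B − A) B⁻¹` with the pointwise inverse letters ⟹ `‖A⁻¹ ∘ inl − B⁻¹ ∘ inl‖ ≤ L² ‖B − A‖`; (§2) on
a chart, HSBD's conclusions in: `‖σ′(w) − σ′(w′)‖ ≤ L² ‖Φ′(σ w) − Φ′(σ w′)‖`, hence `≤ L²·M·K·‖w − w′‖` from a Lipschitz letter for
`Φ′` on the ball (`M`) and for `σ` (`K`, HSCR's `(N⁻¹ − c)⁻¹`), continuity of `σ′` from continuity of `Φ′`, and `ContDiffOn ℝ 1 σ` on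
the open ball; (§3) the critical chart `Φ′ x = (D, V″ x ∘ ι)`, `‖ι‖ ≤ 1`: `‖Φ′ x − Φ′ x′‖ ≤ ‖V″ x − V″ x′‖`, so everything is read off
`V″` alone — THE END `norm_fderiv_sub_fderiv_le_of_criticalChart` ∕ `lipschitzOnWith_fderiv_of_criticalChart` ∕
`contDiffOn_one_of_criticalChart` in HSBD `hasFDerivAt_criticalBranch_of_chart`'s letters and conclusions.

WHAT IS PROVED ([folklore]; the second resolvent identity, e.g. Kato, *Perturbation Theory for Linear Operators* I-(4.12); Dieudonné
(10.2.3); nothing cited as a fact; nearest tree items: Mathlib `ContinuousLinearEquiv.isOpen` ∕ `NormedRing.inverse_continuousAt`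
(qualitative continuity of inversion), none with the two-sided constant `L²`).
* §1 `symm_sub_symm_apply` (`A⁻¹ z − B⁻¹ z = A⁻¹ ((B − A)(B⁻¹ z))`), **`norm_symm_sub_symm_apply_le`** (`≤ L²‖B − A‖‖z‖`),
  **`norm_symm_comp_inl_sub_le`** (`‖A⁻¹ ∘ inl − B⁻¹ ∘ inl‖ ≤ L² ‖B − A‖`, sup norm on `F × H`).
* §2 (chart `Φ′`, section `σ` on a set `s`, derivative letters `hσ′ : ∀ w ∈ s, ∃ A, A = Φ′(σ w) ∧ ‖A⁻¹ z‖ ≤ L‖z‖ ∧ HasFDerivAt σ (A⁻¹ ∘ inl) w`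
  — HSBD §3's conclusion verbatim): **`norm_fderiv_sub_fderiv_le_of_chart`** (`‖fderiv σ w − fderiv σ w′‖ ≤ L² ‖Φ′(σ w) − Φ′(σ w′)‖`),
  **`norm_fderiv_sub_fderiv_le_mul_of_chart`** (`Φ′` `M`-Lipschitz on `closedBall δ₀ r` ∋ `σ w`, `σ` `K`-Lipschitz on `s` ⟹
  `≤ L²·M·K·‖w − w′‖`), `continuousOn_fderiv_of_chart` (`Φ′` continuous on the ball, `σ` continuous on `s` ⟹ `fderiv σ` continuous on
  `s`), **`contDiffOn_one_of_chart`** (`s` open ⟹ `ContDiffOn ℝ 1 σ s`).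
* §3 `norm_prod_comp_sub_prod_comp_le` (`‖ι‖ ≤ 1 ⟹ ‖(D, V″ x ∘ ι) − (D, V″ x′ ∘ ι)‖ ≤ ‖V″ x − V″ x′‖`), THE END in HSBD §5's letters:
  **`norm_fderiv_sub_fderiv_le_of_criticalChart`** (`‖σ′(w) − σ′(w′)‖ ≤ (N⁻¹ − c)⁻² ‖V″(σ w) − V″(σ w′)‖` on `ball (Dδ₀) ρ`),
  **`lipschitzWith_fderiv_of_criticalChart`** (`‖V″ x − V″ x′‖ ≤ M₃‖x − x′‖` on `closedBall δ₀ r`, `σ` `K`-Lipschitz ⟹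
  `‖σ′(w) − σ′(w′)‖ ≤ (N⁻¹ − c)⁻²·M₃·K·‖w − w′‖`), **`contDiffOn_one_of_criticalChart`** (`V″` continuous on `closedBall δ₀ r`, `‖ι‖ ≤ 1` ⟹
  `ContDiffOn ℝ 1 σ (ball (Dδ₀) ρ)`).
* §4 toy (`example`): `A = B` gives modulus `0`.

NOT HERE (honest): `C²` and analyticity of `σ` with constants (the successive-approximation series of [B11] p. 296; leaf-03's CMRA has
the qualitative class); which `V, D, ι, N, c, r, ρ, M₃` are Bałaban's ((A3) ∕ (A1c), NC-NE7b-α UNRULED); anything of Bałaban's.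
BY-NAME EFFECT ON THE WALL: NONE.  NE7b NOT PRINTED ∕ NOT PROVED; spine PROVED 0∕9; rung (B)+1 on a FINITE torus — NOT infinite volume,
NOT the mass gap, NOT Clay.  HONEST DEPENDENCY: continuum YM on T⁴ ⇐ BetaPertH ∧ nine spine estimates (0/9 proved); BetaPertH ⇐ (D1) ∧
(D4) ∧ CAP+tail; G-an2-4 gates asym, D1 and NE2∕3∕4.
-/

set_option autoImplicit false

noncomputable section

namespace Summit.QuantumFields.BalabanUV.T4Continuum.NE7b.HardStepBranchDerivModulus

open Set Filter Topology Function Metric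
open scoped NNReal

variable {E G : Type*} [NormedAddCommGroup E] [NormedSpace ℝ E] [NormedAddCommGroup G] [NormedSpace ℝ G]

/-! ## §1. The resolvent identity with the pointwise inverse letters -/

/-- **RESOLVENT IDENTITY**: `A⁻¹ z − B⁻¹ z = A⁻¹ ((B − A) (B⁻¹ z))`. [folklore] -/
theorem symm_sub_symm_apply (A B : E ≃L[ℝ] G) (z : G) :
    A.symm z - B.symm z = A.symm (((B : E →L[ℝ] G) - (A : E →L[ℝ] G)) (B.symm z)) := by
  simp

/-- `‖A⁻¹ y‖ ≤ L‖y‖`, `‖B⁻¹ y‖ ≤ L‖y‖` ⟹ `‖A⁻¹ z − B⁻¹ z‖ ≤ L² ‖B − A‖ ‖z‖`. [folklore] -/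
theorem norm_symm_sub_symm_apply_le (A B : E ≃L[ℝ] G) {L : ℝ} (hL : 0 ≤ L)
    (hA : ∀ y : G, ‖A.symm y‖ ≤ L * ‖y‖) (hB : ∀ y : G, ‖B.symm y‖ ≤ L * ‖y‖) (z : G) :
    ‖A.symm z - B.symm z‖ ≤ L ^ 2 * ‖(B : E →L[ℝ] G) - (A : E →L[ℝ] G)‖ * ‖z‖ := by
  rw [symm_sub_symm_apply]
  calc ‖A.symm ((((B : E →L[ℝ] G) - (A : E →L[ℝ] G))) (B.symm z))‖
        ≤ L * ‖(((B : E →L[ℝ] G) - (A : E →L[ℝ] G))) (B.symm z)‖ := hA _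
    _ ≤ L * (‖(B : E →L[ℝ] G) - (A : E →L[ℝ] G)‖ * ‖B.symm z‖) :=
        mul_le_mul_of_nonneg_left (ContinuousLinearMap.le_opNorm _ _) hL
    _ ≤ L * (‖(B : E →L[ℝ] G) - (A : E →L[ℝ] G)‖ * (L * ‖z‖)) :=
        mul_le_mul_of_nonneg_left (mul_le_mul_of_nonneg_left (hB z) (norm_nonneg _)) hL
    _ = L ^ 2 * ‖(B : E →L[ℝ] G) - (A : E →L[ℝ] G)‖ * ‖z‖ := by ring

section Slice

variable {F H : Type*} [NormedAddCommGroup F] [NormedSpace ℝ F] [NormedAddCommGroup H] [NormedSpace ℝ H]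

/-- **THE GRAPH DERIVATIVES DIFFER BY AT MOST `L² ‖B − A‖`**: `‖A⁻¹ ∘ inl − B⁻¹ ∘ inl‖ ≤ L² ‖B − A‖` (sup norm on `F × H`,
`‖(k, 0)‖ = ‖k‖`). [folklore] -/
theorem norm_symm_comp_inl_sub_le (A B : E ≃L[ℝ] F × H) {L : ℝ} (hL : 0 ≤ L)
    (hA : ∀ y : F × H, ‖A.symm y‖ ≤ L * ‖y‖) (hB : ∀ y : F × H, ‖B.symm y‖ ≤ L * ‖y‖) :
    ‖(A.symm : F × H →L[ℝ] E).comp (ContinuousLinearMap.inl ℝ F H) -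
        (B.symm : F × H →L[ℝ] E).comp (ContinuousLinearMap.inl ℝ F H)‖ ≤
      L ^ 2 * ‖(B : E →L[ℝ] F × H) - (A : E →L[ℝ] F × H)‖ := by
  refine ContinuousLinearMap.opNorm_le_bound _ (by positivity) fun k => ?_
  have h := norm_symm_sub_symm_apply_le A B hL hA hB (k, 0)
  have hk : ‖((k, 0) : F × H)‖ = ‖k‖ := by simp [Prod.norm_def]
  rw [hk] at h
  simpa using h

/-! ## §2. On a chart: the derivative of the section inherits the modulus of `Φ′` -/

/-- **`‖σ′(w) − σ′(w′)‖ ≤ L² ‖Φ′(σ w) − Φ′(σ w′)‖`** — HSBD `hasFDerivAt_sliceBranch_of_chart`'s conclusions in (for `w ∈ s` an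
equivalence `A` with `A = Φ′(σ w)`, `‖A⁻¹ z‖ ≤ L‖z‖`, `HasFDerivAt σ (A⁻¹ ∘ inl) w`), the modulus of `fderiv ℝ σ` out. [folklore] -/
theorem norm_fderiv_sub_fderiv_le_of_chart {Φ' : E → E →L[ℝ] F × H} {σ : F → E} {s : Set F} {L : ℝ} (hL : 0 ≤ L)
    (hσ' : ∀ w ∈ s, ∃ A : E ≃L[ℝ] F × H, (A : E →L[ℝ] F × H) = Φ' (σ w) ∧
      (∀ z : F × H, ‖A.symm z‖ ≤ L * ‖z‖) ∧
      HasFDerivAt σ ((A.symm : F × H →L[ℝ] E).comp (ContinuousLinearMap.inl ℝ F H)) w)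
    {w w' : F} (hw : w ∈ s) (hw' : w' ∈ s) :
    ‖fderiv ℝ σ w - fderiv ℝ σ w'‖ ≤ L ^ 2 * ‖Φ' (σ w) - Φ' (σ w')‖ := by
  obtain ⟨A, hAeq, hAinv, hA⟩ := hσ' w hw
  obtain ⟨B, hBeq, hBinv, hB⟩ := hσ' w' hw'
  rw [hA.fderiv, hB.fderiv, ← hAeq, ← hBeq, norm_sub_rev (A : E →L[ℝ] F × H)]
  exact norm_symm_comp_inl_sub_le A B hL hAinv hBinv

/-- **LIPSCHITZ `σ′`**: with `Φ′` `M`-Lipschitz on `closedBall δ₀ r` (`‖Φ′ x − Φ′ x′‖ ≤ M‖x − x′‖`), `σ` mapping `s` into that ball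
and `K`-Lipschitz on `s` (`‖σ w − σ w′‖ ≤ K‖w − w′‖`), `‖σ′(w) − σ′(w′)‖ ≤ L²·M·K·‖w − w′‖`. [folklore] -/
theorem norm_fderiv_sub_fderiv_le_mul_of_chart {Φ' : E → E →L[ℝ] F × H} {σ : F → E} {s : Set F} {L M K : ℝ}
    (hL : 0 ≤ L) (hM : 0 ≤ M) {δ₀ : E} {r : ℝ}
    (hΦ'lip : ∀ x ∈ closedBall δ₀ r, ∀ x' ∈ closedBall δ₀ r, ‖Φ' x - Φ' x'‖ ≤ M * ‖x - x'‖)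
    (hσball : ∀ w ∈ s, σ w ∈ closedBall δ₀ r) (hσlip : ∀ w ∈ s, ∀ w' ∈ s, ‖σ w - σ w'‖ ≤ K * ‖w - w'‖)
    (hσ' : ∀ w ∈ s, ∃ A : E ≃L[ℝ] F × H, (A : E →L[ℝ] F × H) = Φ' (σ w) ∧
      (∀ z : F × H, ‖A.symm z‖ ≤ L * ‖z‖) ∧
      HasFDerivAt σ ((A.symm : F × H →L[ℝ] E).comp (ContinuousLinearMap.inl ℝ F H)) w)
    {w w' : F} (hw : w ∈ s) (hw' : w' ∈ s) :
    ‖fderiv ℝ σ w - fderiv ℝ σ w'‖ ≤ L ^ 2 * M * K * ‖w - w'‖ := by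
  refine (norm_fderiv_sub_fderiv_le_of_chart hL hσ' hw hw').trans ?_
  have h1 := hΦ'lip _ (hσball w hw) _ (hσball w' hw')
  have h2 := hσlip w hw w' hw'
  calc L ^ 2 * ‖Φ' (σ w) - Φ' (σ w')‖ ≤ L ^ 2 * (M * ‖σ w - σ w'‖) :=
        mul_le_mul_of_nonneg_left h1 (by positivity)
    _ ≤ L ^ 2 * (M * (K * ‖w - w'‖)) :=
        mul_le_mul_of_nonneg_left (mul_le_mul_of_nonneg_left h2 hM) (by positivity)
    _ = L ^ 2 * M * K * ‖w - w'‖ := by ring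

/-- **CONTINUOUS `σ′`**: `Φ′` continuous on `closedBall δ₀ r`, `σ` continuous on `s` into that ball ⟹ `fderiv ℝ σ` continuous on
`s`. [folklore] -/
theorem continuousOn_fderiv_of_chart {Φ' : E → E →L[ℝ] F × H} {σ : F → E} {s : Set F} {L : ℝ} (hL : 0 ≤ L)
    {δ₀ : E} {r : ℝ} (hΦ'c : ContinuousOn Φ' (closedBall δ₀ r))
    (hσball : ∀ w ∈ s, σ w ∈ closedBall δ₀ r) (hσc : ContinuousOn σ s)
    (hσ' : ∀ w ∈ s, ∃ A : E ≃L[ℝ] F × H, (A : E →L[ℝ] F × H) = Φ' (σ w) ∧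
      (∀ z : F × H, ‖A.symm z‖ ≤ L * ‖z‖) ∧
      HasFDerivAt σ ((A.symm : F × H →L[ℝ] E).comp (ContinuousLinearMap.inl ℝ F H)) w) :
    ContinuousOn (fderiv ℝ σ) s := by
  have hcomp : ContinuousOn (fun w => Φ' (σ w)) s := hΦ'c.comp hσc fun w hw => hσball w hw
  rw [Metric.continuousOn_iff] at hcomp ⊢
  intro w hw ε hε
  have hL2 : 0 ≤ L ^ 2 := by positivity
  obtain ⟨δ, hδ, hball⟩ := hcomp w hw (ε / (L ^ 2 + 1)) (by positivity)
  refine ⟨δ, hδ, fun w' hw' hd => ?_⟩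
  rw [dist_eq_norm]
  have h1 := norm_fderiv_sub_fderiv_le_of_chart hL hσ' hw' hw
  have h2 : ‖Φ' (σ w') - Φ' (σ w)‖ < ε / (L ^ 2 + 1) := by
    have h := hball w' hw' hd
    rwa [dist_eq_norm] at h
  calc ‖fderiv ℝ σ w' - fderiv ℝ σ w‖ ≤ L ^ 2 * ‖Φ' (σ w') - Φ' (σ w)‖ := h1
    _ ≤ L ^ 2 * (ε / (L ^ 2 + 1)) := mul_le_mul_of_nonneg_left h2.le hL2
    _ < ε := by
        rw [mul_div_assoc']
        rw [div_lt_iff₀ (by positivity)]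
        nlinarith

/-- **`σ ∈ C¹(s)`** for `s` open: HSBD's derivative letters + continuity of `Φ′` on the ball and of `σ` on `s` ⟹ `ContDiffOn ℝ 1 σ s`.
[folklore] -/
theorem contDiffOn_one_of_chart {Φ' : E → E →L[ℝ] F × H} {σ : F → E} {s : Set F} (hs : IsOpen s) {L : ℝ} (hL : 0 ≤ L)
    {δ₀ : E} {r : ℝ} (hΦ'c : ContinuousOn Φ' (closedBall δ₀ r))
    (hσball : ∀ w ∈ s, σ w ∈ closedBall δ₀ r) (hσc : ContinuousOn σ s)
    (hσ' : ∀ w ∈ s, ∃ A : E ≃L[ℝ] F × H, (A : E →L[ℝ] F × H) = Φ' (σ w) ∧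
      (∀ z : F × H, ‖A.symm z‖ ≤ L * ‖z‖) ∧
      HasFDerivAt σ ((A.symm : F × H →L[ℝ] E).comp (ContinuousLinearMap.inl ℝ F H)) w) :
    ContDiffOn ℝ 1 σ s := by
  have hdiff : DifferentiableOn ℝ σ s := fun w hw => by
    obtain ⟨A, -, -, hA⟩ := hσ' w hw
    exact hA.differentiableAt.differentiableWithinAt
  have hcont := continuousOn_fderiv_of_chart hL hΦ'c hσball hσc hσ'
  have h : ContDiffOn ℝ (0 + 1) σ s := by
    rw [contDiffOn_succ_iff_fderiv_of_isOpen hs]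
    exact ⟨hdiff, fun h0 => absurd h0 (by simp), contDiffOn_zero.2 hcont⟩
  simpa using h

end Slice

/-! ## §3. THE END on the critical chart: the modulus of `σ′` is the modulus of `V″` along the branch -/

section Critical

variable {F : Type*} [NormedAddCommGroup F] [NormedSpace ℝ F]
variable {K : Type*} [NormedAddCommGroup K] [NormedSpace ℝ K]

/-- The critical chart's derivative moves only through `V″`: `‖ι‖ ≤ 1 ⟹ ‖(D, V″ₓ ∘ ι) − (D, V″ₓ′ ∘ ι)‖ ≤ ‖V″ₓ − V″ₓ′‖`
(sup norm; `(V″ h) ∘ ι = R (V″ h)` with `‖R‖ ≤ ‖ι‖`). [folklore] -/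
theorem norm_prod_comp_sub_prod_comp_le (ι : K →L[ℝ] E) (hι : ‖ι‖ ≤ 1) (D : E →L[ℝ] F) (B B' : E →L[ℝ] E →L[ℝ] ℝ) :
    ‖D.prod (((ContinuousLinearMap.compL ℝ K E ℝ).flip ι).comp B) -
        D.prod (((ContinuousLinearMap.compL ℝ K E ℝ).flip ι).comp B')‖ ≤ ‖B - B'‖ := by
  set R : (E →L[ℝ] ℝ) →L[ℝ] (K →L[ℝ] ℝ) := (ContinuousLinearMap.compL ℝ K E ℝ).flip ι with hR
  have hRapply : ∀ L : E →L[ℝ] ℝ, R L = L.comp ι := fun L => rfl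
  have hRnorm : ‖R‖ ≤ 1 := by
    refine ContinuousLinearMap.opNorm_le_bound _ zero_le_one fun L => ?_
    rw [hRapply, one_mul]
    exact (L.opNorm_comp_le ι).trans (mul_le_of_le_one_right (norm_nonneg _) hι)
  have h1 : D.prod (R.comp B) - D.prod (R.comp B') = (0 : E →L[ℝ] F).prod (R.comp (B - B')) := by
    ext h <;> simp
  rw [h1, ContinuousLinearMap.opNorm_prod, Prod.norm_def, norm_zero, max_eq_right (norm_nonneg _)]
  refine (ContinuousLinearMap.opNorm_comp_le _ _).trans ?_
  calc ‖R‖ * ‖B - B'‖ ≤ 1 * ‖B - B'‖ := mul_le_mul_of_nonneg_right hRnorm (norm_nonneg (B - B'))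
    _ = ‖B - B'‖ := one_mul _

/-- **THE MODULUS OF THE BACKGROUND FIELD'S DERIVATIVE IS THE MODULUS OF THE HESSIAN ALONG THE BRANCH** — HSBD
`hasFDerivAt_criticalBranch_of_chart`'s letters (`ι`, `D`, `V″`, `N`, `c`) and conclusions in (for `w ∈ ball (Dδ₀) ρ` an equivalence
`A` with `A h = (D h, V″(σ w) h ∘ ι)`, `‖A⁻¹ z‖ ≤ (N⁻¹ − c)⁻¹‖z‖`, `HasFDerivAt σ (A⁻¹ ∘ inl) w`; `‖ι‖ ≤ 1`, `c < N⁻¹`):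
`‖σ′(w) − σ′(w′)‖ ≤ (N⁻¹ − c)⁻² ‖V″(σ w) − V″(σ w′)‖` for all `w, w′` in the ball. [folklore] -/
theorem norm_fderiv_sub_fderiv_le_of_criticalChart (ι : K →L[ℝ] E) (hι : ‖ι‖ ≤ 1) (D : E →L[ℝ] F)
    {V'' : E → E →L[ℝ] E →L[ℝ] ℝ} {σ : F → E} {w₀ : F} {ρ : ℝ} {N c : ℝ≥0} (hc : c < N⁻¹)
    (hσ' : ∀ w ∈ ball w₀ ρ, ∃ A : E ≃L[ℝ] F × (K →L[ℝ] ℝ), (∀ h, A h = (D h, (V'' (σ w) h).comp ι)) ∧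
      (∀ z, ‖A.symm z‖ ≤ ((N : ℝ)⁻¹ - c)⁻¹ * ‖z‖) ∧
      HasFDerivAt σ ((A.symm : F × (K →L[ℝ] ℝ) →L[ℝ] E).comp (ContinuousLinearMap.inl ℝ F (K →L[ℝ] ℝ))) w)
    {w w' : F} (hw : w ∈ ball w₀ ρ) (hw' : w' ∈ ball w₀ ρ) :
    ‖fderiv ℝ σ w - fderiv ℝ σ w'‖ ≤ (((N : ℝ)⁻¹ - c)⁻¹) ^ 2 * ‖V'' (σ w) - V'' (σ w')‖ := by
  set R : (E →L[ℝ] ℝ) →L[ℝ] (K →L[ℝ] ℝ) := (ContinuousLinearMap.compL ℝ K E ℝ).flip ι with hR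
  set Φ' : E → E →L[ℝ] F × (K →L[ℝ] ℝ) := fun x => D.prod (R.comp (V'' x)) with hΦ'
  have hc' : (c : ℝ) < (N : ℝ)⁻¹ := by
    have h := NNReal.coe_lt_coe.2 hc
    rwa [NNReal.coe_inv] at h
  have hL : (0 : ℝ) ≤ ((N : ℝ)⁻¹ - c)⁻¹ := inv_nonneg.2 (sub_pos.2 hc').le
  have hσ'' : ∀ w ∈ ball w₀ ρ, ∃ A : E ≃L[ℝ] F × (K →L[ℝ] ℝ), (A : E →L[ℝ] F × (K →L[ℝ] ℝ)) = Φ' (σ w) ∧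
      (∀ z, ‖A.symm z‖ ≤ ((N : ℝ)⁻¹ - c)⁻¹ * ‖z‖) ∧
      HasFDerivAt σ ((A.symm : F × (K →L[ℝ] ℝ) →L[ℝ] E).comp (ContinuousLinearMap.inl ℝ F (K →L[ℝ] ℝ))) w := by
    intro w hw
    obtain ⟨A, hA, hAinv, hder⟩ := hσ' w hw
    refine ⟨A, ?_, hAinv, hder⟩
    ext h
    · simp [hΦ', hA h]
    · simp [hΦ', hA h, hR]
  refine (norm_fderiv_sub_fderiv_le_of_chart hL hσ'' hw hw').trans ?_
  exact mul_le_mul_of_nonneg_left (norm_prod_comp_sub_prod_comp_le ι hι D _ _) (by positivity)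

/-- **LIPSCHITZ `σ′` FROM A THIRD-DERIVATIVE LETTER**: under the same letters, if `‖V″ x − V″ x′‖ ≤ M₃‖x − x′‖` on `closedBall δ₀ r`,
`σ` maps the ball into `closedBall δ₀ r` and is `K₁`-Lipschitz there (HSCR: `K₁ = (N⁻¹ − c)⁻¹`), then
`‖σ′(w) − σ′(w′)‖ ≤ (N⁻¹ − c)⁻²·M₃·K₁·‖w − w′‖`. [folklore] -/
theorem lipschitzWith_fderiv_of_criticalChart (ι : K →L[ℝ] E) (hι : ‖ι‖ ≤ 1) (D : E →L[ℝ] F)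
    {V'' : E → E →L[ℝ] E →L[ℝ] ℝ} {σ : F → E} {w₀ : F} {ρ : ℝ} {N c : ℝ≥0} (hc : c < N⁻¹)
    {δ₀ : E} {r M₃ K₁ : ℝ} (hM₃ : 0 ≤ M₃)
    (hV''lip : ∀ x ∈ closedBall δ₀ r, ∀ x' ∈ closedBall δ₀ r, ‖V'' x - V'' x'‖ ≤ M₃ * ‖x - x'‖)
    (hσball : ∀ w ∈ ball w₀ ρ, σ w ∈ closedBall δ₀ r)
    (hσlip : ∀ w ∈ ball w₀ ρ, ∀ w' ∈ ball w₀ ρ, ‖σ w - σ w'‖ ≤ K₁ * ‖w - w'‖)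
    (hσ' : ∀ w ∈ ball w₀ ρ, ∃ A : E ≃L[ℝ] F × (K →L[ℝ] ℝ), (∀ h, A h = (D h, (V'' (σ w) h).comp ι)) ∧
      (∀ z, ‖A.symm z‖ ≤ ((N : ℝ)⁻¹ - c)⁻¹ * ‖z‖) ∧
      HasFDerivAt σ ((A.symm : F × (K →L[ℝ] ℝ) →L[ℝ] E).comp (ContinuousLinearMap.inl ℝ F (K →L[ℝ] ℝ))) w)
    {w w' : F} (hw : w ∈ ball w₀ ρ) (hw' : w' ∈ ball w₀ ρ) :
    ‖fderiv ℝ σ w - fderiv ℝ σ w'‖ ≤ (((N : ℝ)⁻¹ - c)⁻¹) ^ 2 * M₃ * K₁ * ‖w - w'‖ := by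
  refine (norm_fderiv_sub_fderiv_le_of_criticalChart ι hι D hc hσ' hw hw').trans ?_
  have h1 := hV''lip _ (hσball w hw) _ (hσball w' hw')
  have h2 := hσlip w hw w' hw'
  have hL2 : (0 : ℝ) ≤ (((N : ℝ)⁻¹ - c)⁻¹) ^ 2 := sq_nonneg _
  calc (((N : ℝ)⁻¹ - c)⁻¹) ^ 2 * ‖V'' (σ w) - V'' (σ w')‖ ≤ (((N : ℝ)⁻¹ - c)⁻¹) ^ 2 * (M₃ * ‖σ w - σ w'‖) :=
        mul_le_mul_of_nonneg_left h1 hL2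
    _ ≤ (((N : ℝ)⁻¹ - c)⁻¹) ^ 2 * (M₃ * (K₁ * ‖w - w'‖)) :=
        mul_le_mul_of_nonneg_left (mul_le_mul_of_nonneg_left h2 hM₃) hL2
    _ = (((N : ℝ)⁻¹ - c)⁻¹) ^ 2 * M₃ * K₁ * ‖w - w'‖ := by ring

/-- **`σ ∈ C¹` ON THE OPEN CHART**: under the same letters, `V″` continuous on `closedBall δ₀ r` and `σ` continuous on the ball into
`closedBall δ₀ r` ⟹ `ContDiffOn ℝ 1 σ (ball (Dδ₀) ρ)`. [folklore] -/
theorem contDiffOn_one_of_criticalChart (ι : K →L[ℝ] E) (hι : ‖ι‖ ≤ 1) (D : E →L[ℝ] F)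
    {V'' : E → E →L[ℝ] E →L[ℝ] ℝ} {σ : F → E} {w₀ : F} {ρ : ℝ} {N c : ℝ≥0} (hc : c < N⁻¹)
    {δ₀ : E} {r : ℝ} (hV''c : ContinuousOn V'' (closedBall δ₀ r))
    (hσball : ∀ w ∈ ball w₀ ρ, σ w ∈ closedBall δ₀ r) (hσc : ContinuousOn σ (ball w₀ ρ))
    (hσ' : ∀ w ∈ ball w₀ ρ, ∃ A : E ≃L[ℝ] F × (K →L[ℝ] ℝ), (∀ h, A h = (D h, (V'' (σ w) h).comp ι)) ∧
      (∀ z, ‖A.symm z‖ ≤ ((N : ℝ)⁻¹ - c)⁻¹ * ‖z‖) ∧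
      HasFDerivAt σ ((A.symm : F × (K →L[ℝ] ℝ) →L[ℝ] E).comp (ContinuousLinearMap.inl ℝ F (K →L[ℝ] ℝ))) w) :
    ContDiffOn ℝ 1 σ (ball w₀ ρ) := by
  set R : (E →L[ℝ] ℝ) →L[ℝ] (K →L[ℝ] ℝ) := (ContinuousLinearMap.compL ℝ K E ℝ).flip ι with hR
  set Φ' : E → E →L[ℝ] F × (K →L[ℝ] ℝ) := fun x => D.prod (R.comp (V'' x)) with hΦ'
  have hc' : (c : ℝ) < (N : ℝ)⁻¹ := by
    have h := NNReal.coe_lt_coe.2 hc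
    rwa [NNReal.coe_inv] at h
  have hL : (0 : ℝ) ≤ ((N : ℝ)⁻¹ - c)⁻¹ := inv_nonneg.2 (sub_pos.2 hc').le
  have hΦ'c : ContinuousOn Φ' (closedBall δ₀ r) := by
    have h1 : LipschitzWith 1 fun B : E →L[ℝ] E →L[ℝ] ℝ => D.prod (R.comp B) :=
      LipschitzWith.of_dist_le_mul fun B B' => by
        rw [dist_eq_norm, dist_eq_norm, NNReal.coe_one, one_mul]
        exact norm_prod_comp_sub_prod_comp_le ι hι D B B'
    exact h1.continuous.comp_continuousOn hV''c
  have hσ'' : ∀ w ∈ ball w₀ ρ, ∃ A : E ≃L[ℝ] F × (K →L[ℝ] ℝ), (A : E →L[ℝ] F × (K →L[ℝ] ℝ)) = Φ' (σ w) ∧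
      (∀ z, ‖A.symm z‖ ≤ ((N : ℝ)⁻¹ - c)⁻¹ * ‖z‖) ∧
      HasFDerivAt σ ((A.symm : F × (K →L[ℝ] ℝ) →L[ℝ] E).comp (ContinuousLinearMap.inl ℝ F (K →L[ℝ] ℝ))) w := by
    intro w hw
    obtain ⟨A, hA, hAinv, hder⟩ := hσ' w hw
    refine ⟨A, ?_, hAinv, hder⟩
    ext h
    · simp [hΦ', hA h]
    · simp [hΦ', hA h, hR]
  exact contDiffOn_one_of_chart isOpen_ball hL hΦ'c hσball hσc hσ''

end Critical

/-! ## §4. Toy -/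

/-- Toy: `A = B` — the two graph derivatives coincide and the bound reads `0 ≤ L²·0`. [folklore] -/
example (A : ℝ ≃L[ℝ] ℝ × ℝ) {L : ℝ} (hL : 0 ≤ L) (hA : ∀ y : ℝ × ℝ, ‖A.symm y‖ ≤ L * ‖y‖) :
    ‖(A.symm : ℝ × ℝ →L[ℝ] ℝ).comp (ContinuousLinearMap.inl ℝ ℝ ℝ) -
        (A.symm : ℝ × ℝ →L[ℝ] ℝ).comp (ContinuousLinearMap.inl ℝ ℝ ℝ)‖ ≤
      L ^ 2 * ‖(A : ℝ →L[ℝ] ℝ × ℝ) - (A : ℝ →L[ℝ] ℝ × ℝ)‖ :=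
  norm_symm_comp_inl_sub_le A A hL hA hA

end Summit.QuantumFields.BalabanUV.T4Continuum.NE7b.HardStepBranchDerivModulus

end
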